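/-
Copyright (c) 2026 the pub-hodgecm-mathlib formalisation cell (harness21).  Prover seat hodgecm-mathlib-LH4-p10 (g6): Track A «(D-RAM) FOUR-FRAME» squad of crux H413, (β) TABLE —
sub-dealer LH4-p05 (g8) β-BOARD LEDGER #12 «LH4-p10 → `harith`»; fork (a) decided by LH4-cdis1 (g0) 16:10:51Z; assembler F0P3a-p01 (g37).  2026-09-04.
-/
import Summits.HodgeConjecture.HodgeConjecture.Theorems.F0P3cDyRamOddLabelledBoxSumDefs    -- ★ p861261 (T1): `restTarget`
import Summits.HodgeConjecture.HodgeConjecture.Theorems.F0P3cDyRamOddLabelledRestLines      -- ★ p861629∕p861705 (this seat): `rest_sum_eq_hanging_add_lines`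
import Summits.HodgeConjecture.HodgeConjecture.Theorems.F0P3cDyRamKappaClassLineTotal       -- ★ p861700 (LH4-p08 (g10)): `kappaClass_line_total_of_offFoot`
import HarnessLib

/-!
# Crux `H413`, line LH4 «(D-RAM) FOUR-FRAME» — (β) TABLE, `harith` STEP 2: THE REST VALUES SUM TO `restTarget` (fork (a), symmetric tokens)

Cell `hodgecm-mathlib` (D-0151), FLOOR 0, crux item H413 = `stmt-HodgeConjecture-24833`, route `HCCMUnconditional`; squad F0∕P3c∕LH4.  THEOREMS ONLY (pure `Finset` ∕ `ℚ`
bookkeeping); lane `--supports stmt-HodgeConjecture-24833 --as helper` (count-neutral).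

WHAT.  `harith_of_values`: the `harith` binder of F0P3a-p01 (g37)'s ★ socket `…OddLabelledRestReindex.sum_box_restShape_eq_of_rows` with `R := restTarget q d n₁ n₂ n₃ ωA ωB ωC ωm i`,
DISCHARGED from the rest-row VALUES in the letters the row files deliver: the three tower dispatchers (★ `restValue_G1_of_rows`, ★ `restValue_G2_of_rows`, tower 3 analogous) put
`VG k ρ s = if 2ρ + ℓ₀ = c_k ∧ T_k s then κ_k ρ s else 0` (`c₀ = n₂`, `T₀ s ↔ n₁ ≠ n₂ + s`; `c₁ = n₁`, `T₁ s ↔ n₂ ≠ n₁ + s`; `c₂ = n₂`, `T₂ s ↔ n₃ ≠ n₂ + s`); the κ-CLASS ROWS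
(R6, LH4-p08 (g10) R6-DERIVATION v2 ∕ LH4-cdis1 (g0) fork (a): the «q∕2» reading) `κ_k ρ s = τ_k(i)∕4 · q^{2ρ−1+s∕2} · ((q−1)[2d+ℓ₀+2ρ+s ≤ n_{X_k}] − [n_{X_k}+2 = 2d+ℓ₀+2ρ+s])` with the
SYMMETRIC own-slot tokens `τ₀ = (ωA + ωm ωC, 0, 0)`, `τ₁ = (0, ωB + ωC, 0)`, `τ₂ = (0, 0, ωm ωB + ωm ωA)` (the letters `restTarget` forces — LH4-p10 RESIDUE LEDGER #1∕#2: a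
head carrying ONE token `ωm ωB∕2` agrees iff `ωA = ωB`); and the HANGING ROW (R8, LH7-p08 (g0) FILE 3b, confirmed at q = 4 by cdis1) zero off `2ρ + ℓ₀ = min n₁ n₂` and there
`= T(i)∕4 · q^{min−ℓ₀−1} · ((q−2)[special_i ∧ s_g ≥ 2d] − 2[special_i ∧ s_g = 2d−2])`.  ENGINE: ★ p861705 `rest_sum_eq_hanging_add_lines` (one hanging point + three foot lines), ★
p861700 `kappaClass_line_total_of_offFoot` per tower (line `= −τ∕4·q^{c_k−ℓ₀}·[c_k + 2d ≤ n_{X_k}]`), then `restTarget`'s three `if`s by `hiso`.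
HONEST LABEL.  Count-neutral bookkeeping on the POSTED row letters (fork (a)); the rows themselves (R6 heads, R8 head) are NOT proved here; hRest∕(β) OPEN; `HC_CM` is proved only
modulo the 7 printed citations (2 remaining named inputs: hLiu418 = `stmt-HodgeConjecture-24832`, h413 = `stmt-HodgeConjecture-24833`) until rung 0 closes.

## References
* [Kottwitz1986BaseChangeUnits] R. E. Kottwitz, *Base change for unit elements of Hecke algebras*, Compositio Math. 60 (1986), §1 pp. 240–241.
* [Rogawski1990] J. D. Rogawski, *Automorphic Representations of Unitary Groups in Three Variables*, Ann. of Math. Stud. 123 (1990), §4.9 Prop. 4.9.1 (a)(b) p. 55; §4.10 p. 58.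
-/

set_option autoImplicit false

namespace Summit.HodgeConjecture.HodgeConjecture.Cruxes.H413.F0P3cDyRamOddLabelledRestArith

open Finset
open Summit.HodgeConjecture.HodgeConjecture.Cruxes.H413.F0P3cDyRamOddLabelledBoxSumDefs (restTarget)
open Summit.HodgeConjecture.HodgeConjecture.Cruxes.H413.F0P3cDyRamOddLabelledRestLines (rest_sum_eq_hanging_add_lines)
open Summit.HodgeConjecture.HodgeConjecture.Cruxes.H413.F0P3cDyRamKappaClassLineTotal (kappaClass_line_total_of_offFoot)

/-- **ONE κ-CLASS FOOT LINE** in the (T1) bracket currency: on the foot depth `2ρ⋆ + ℓ₀ = c` of a tower with read depth `nX`, the s-line of ★ p861705 (cut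
`(2 ∣ s ∧ ¬cap) ∧ T s` with every even non-`T` or capped `s` ON the read line) of the κ row `τ∕4 · q^{2ρ⋆−1+s∕2} · bracket(nX; 2ρ⋆+s)` totals `−τ∕4·q^{c−ℓ₀}·[2d + c ≤ nX]`
(★ p861700 `kappaClass_line_total_of_offFoot`). [cite: Kottwitz1986BaseChangeUnits, §1 pp. 240–241] -/
theorem foot_line_total (q : ℕ) (τ : ℚ) {d l c nX S ρ : ℕ} (hd : 2 ≤ d) (hpar : nX % 2 = l % 2) (hρ1 : 1 ≤ ρ) (hρ : 2 * ρ + l = c) (hS : nX ≤ 2 * ρ + l + S + 2)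
    (cap T : ℕ → Prop) [DecidablePred cap] [DecidablePred T] (κ : ℕ → ℚ)
    (hcap : ∀ s, cap s → 2 * ρ + s + l = nX) (hT : ∀ s, ¬ T s → 2 * ρ + s + l = nX)
    (hκ : ∀ s, 1 ≤ s → 2 ∣ s → κ s = τ / 4 * (q : ℚ) ^ (2 * ρ - 1 + s / 2) *
      ((if 2 * d + l + 2 * ρ + s ≤ nX then (q : ℚ) - 1 else 0) - (if nX + 2 = 2 * d + l + 2 * ρ + s then 1 else 0))) :
    ∑ s ∈ Icc 1 S, (if (2 ∣ s ∧ ¬ cap s) ∧ T s then κ s else 0) = if c + 2 * d ≤ nX then -(τ / 4 * (q : ℚ) ^ (c - l)) else 0 := by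
  classical
  have hre : ∀ s ∈ Icc 1 S, (if (2 ∣ s ∧ ¬ cap s) ∧ T s then κ s else 0) =
      (if 2 ∣ s ∧ (¬ cap s ∧ T s) then τ / 4 * (q : ℚ) ^ (2 * ρ - 1 + s / 2) *
        ((if 2 * d + l + 2 * ρ + s ≤ nX then (q : ℚ) - 1 else 0) - (if nX + 2 = 2 * d + l + 2 * ρ + s then 1 else 0)) else 0) := by
    intro s hs
    rw [Finset.mem_Icc] at hs
    by_cases h : (2 ∣ s ∧ ¬ cap s) ∧ T s
    · rw [if_pos h, if_pos ⟨h.1.1, h.1.2, h.2⟩, hκ s hs.1 h.1.1]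
    · rw [if_neg h, if_neg (fun h' => h ⟨⟨h'.1, h'.2.1⟩, h'.2.2⟩)]
  rw [Finset.sum_congr rfl hre,
    kappaClass_line_total_of_offFoot (q : ℚ) (τ / 4) (2 * ρ - 1) hd hpar hS (fun s => ¬ cap s ∧ T s) (fun s _ _ _ hq => by
      by_cases hc : cap s
      · exact hcap s hc
      · exact hT s (fun ht => hq ⟨hc, ht⟩))]
  rw [show 2 * ρ - 1 + 1 = c - l by omega]
  by_cases h : 2 * d + l + 2 * ρ ≤ nX
  · rw [if_pos h, if_pos (show c + 2 * d ≤ nX by omega)]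
  · rw [if_neg h, if_neg (show ¬ c + 2 * d ≤ nX by omega)]

/-- **`harith` DISCHARGED FROM THE REST-ROW VALUES (fork (a), symmetric tokens).**  The `harith` binder of ★ `sum_box_restShape_eq_of_rows` at `B := n₁ + n₂ + n₃`,
`R := restTarget q d n₁ n₂ n₃ ωA ωB ωC ωm i`, from: the hanging row `VH` zero off `2ρ + ℓ₀ = min n₁ n₂` and equal there to the R8 value (LH7-p08 FILE 3b:
`T(i)∕4 · q^{m−ℓ₀−1} · ((q−2)[s_g ≥ 2d] − 2[s_g = 2d−2])` in the special slot, `0` else); the three dispatcher shapes `hVG0∕1∕2` (★ `restValue_G1_of_rows` ∕ `_G2_` ∕ tower 3); and the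
κ-class rows `hκ0∕1∕2` in the «q∕2» reading with the symmetric own-slot tokens `(ωA + ωm ωC, ωB + ωC, ωm ωB + ωm ωA)∕4` (R6; LH4-cdis1 fork (a)).
[cite: Kottwitz1986BaseChangeUnits, §1 pp. 240–241] [cite: Rogawski1990, §4.9 Prop. 4.9.1 (a)(b) p. 55] -/
theorem harith_of_values (q : ℕ) {d n₁ n₂ n₃ : ℕ} (hd : 2 ≤ d)
    (hiso : (n₁ = n₂ ∧ n₁ ≤ n₃) ∨ (n₁ = n₃ ∧ n₁ ≤ n₂) ∨ (n₂ = n₃ ∧ n₂ ≤ n₁))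
    (hreg : 3 * d - 2 + d % 2 ≤ n₁ ∧ 3 * d - 2 + d % 2 ≤ n₂ ∧ 3 * d - 2 + d % 2 ≤ n₃)
    (h1 : n₁ % 2 = d % 2) (h2 : n₂ % 2 = d % 2) (h3 : n₃ % 2 = d % 2)
    (i : Fin 3) (ωA ωB ωC ωm : ℤ) (VH : ℕ → ℚ) (VG : Fin 3 → ℕ → ℕ → ℚ) (κ₀ κ₁ κ₂ : ℕ → ℕ → ℚ)
    (hVH0 : ∀ ρ, 1 ≤ ρ → ρ ≤ (n₁ + n₂ + n₃) / 2 → 2 * ρ + d % 2 ≠ min n₁ n₂ → VH ρ = 0)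
    (hVH1 : ∀ ρ, 1 ≤ ρ → 2 * ρ + d % 2 = min n₁ n₂ → VH ρ =
      (![if n₂ = n₃ then ((ωA : ℚ) + ωm * ωC) / 4 * (q : ℚ) ^ (n₂ - d % 2 - 1) *
            ((if n₂ + 2 * d ≤ n₁ then (q : ℚ) - 2 else 0) - (if n₁ + 2 = n₂ + 2 * d then 2 else 0)) else 0,
         if n₁ = n₃ then ((ωB : ℚ) + ωC) / 4 * (q : ℚ) ^ (n₁ - d % 2 - 1) *
            ((if n₁ + 2 * d ≤ n₂ then (q : ℚ) - 2 else 0) - (if n₂ + 2 = n₁ + 2 * d then 2 else 0)) else 0,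
         if n₁ = n₂ then ((ωm : ℚ) * ωB + ωm * ωA) / 4 * (q : ℚ) ^ (n₁ - d % 2 - 1) *
            ((if n₁ + 2 * d ≤ n₃ then (q : ℚ) - 2 else 0) - (if n₃ + 2 = n₁ + 2 * d then 2 else 0)) else 0] : Fin 3 → ℚ) i)
    (hVG0 : ∀ ρ s, VG 0 ρ s = if 2 * ρ + d % 2 = n₂ ∧ n₁ ≠ n₂ + s then κ₀ ρ s else 0)
    (hVG1 : ∀ ρ s, VG 1 ρ s = if 2 * ρ + d % 2 = n₁ ∧ n₂ ≠ n₁ + s then κ₁ ρ s else 0)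
    (hVG2 : ∀ ρ s, VG 2 ρ s = if 2 * ρ + d % 2 = n₂ ∧ n₃ ≠ n₂ + s then κ₂ ρ s else 0)
    (hκ0 : ∀ ρ s, 1 ≤ ρ → 1 ≤ s → 2 ∣ s → 2 * ρ + d % 2 = n₂ → κ₀ ρ s =
      (![(ωA : ℚ) + ωm * ωC, 0, 0] : Fin 3 → ℚ) i / 4 * (q : ℚ) ^ (2 * ρ - 1 + s / 2) *
        ((if 2 * d + d % 2 + 2 * ρ + s ≤ n₁ then (q : ℚ) - 1 else 0) - (if n₁ + 2 = 2 * d + d % 2 + 2 * ρ + s then 1 else 0)))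
    (hκ1 : ∀ ρ s, 1 ≤ ρ → 1 ≤ s → 2 ∣ s → 2 * ρ + d % 2 = n₁ → κ₁ ρ s =
      (![(0 : ℚ), (ωB : ℚ) + ωC, 0] : Fin 3 → ℚ) i / 4 * (q : ℚ) ^ (2 * ρ - 1 + s / 2) *
        ((if 2 * d + d % 2 + 2 * ρ + s ≤ n₂ then (q : ℚ) - 1 else 0) - (if n₂ + 2 = 2 * d + d % 2 + 2 * ρ + s then 1 else 0)))
    (hκ2 : ∀ ρ s, 1 ≤ ρ → 1 ≤ s → 2 ∣ s → 2 * ρ + d % 2 = n₂ → κ₂ ρ s =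
      (![(0 : ℚ), 0, (ωm : ℚ) * ωB + ωm * ωA] : Fin 3 → ℚ) i / 4 * (q : ℚ) ^ (2 * ρ - 1 + s / 2) *
        ((if 2 * d + d % 2 + 2 * ρ + s ≤ n₃ then (q : ℚ) - 1 else 0) - (if n₃ + 2 = 2 * d + d % 2 + 2 * ρ + s then 1 else 0))) :
    ∑ ρ ∈ Icc 1 ((n₁ + n₂ + n₃) / 2), VH ρ
      + ∑ ρ ∈ Icc 1 ((n₁ + n₂ + n₃) / 2), ∑ s ∈ Icc 1 (n₁ + n₂ + n₃ - 2 * ρ),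
          ((if 2 ∣ s ∧ ¬ (2 * ρ + s + d % 2 = n₁ ∧ 2 * ρ + 2 + d % 2 ≤ min n₂ n₃) then VG 0 ρ s else 0)
          + (if 2 ∣ s ∧ ¬ (2 * ρ + s + d % 2 = n₂ ∧ 2 * ρ + 2 + d % 2 ≤ min n₁ n₃) then VG 1 ρ s else 0)
          + (if 2 ∣ s ∧ ¬ (2 * ρ + s + d % 2 = n₃ ∧ 2 * ρ + 2 + d % 2 ≤ min n₁ n₂) then VG 2 ρ s else 0)) =
      restTarget q d n₁ n₂ n₃ ωA ωB ωC ωm i := by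
  classical
  have hl : d % 2 ≤ 1 := Nat.lt_succ_iff.mp (Nat.mod_lt d two_pos)
  rw [rest_sum_eq_hanging_add_lines (n₁ + n₂ + n₃) d n₁ n₂ n₃ (min n₁ n₂) n₂ n₁ n₂ VH VG κ₀ κ₁ κ₂
    (fun s => n₁ ≠ n₂ + s) (fun s => n₂ ≠ n₁ + s) (fun s => n₃ ≠ n₂ + s) hVH0 hVG0 hVG1 hVG2]
  -- name the hanging depth `m = min n₁ n₂`
  obtain ⟨m, hm⟩ : ∃ m, min n₁ n₂ = m := ⟨_, rfl⟩
  have hm' : m = n₁ ∨ m = n₂ := by rw [← hm]; exact min_choice n₁ n₂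
  have hm1 : m ≤ n₁ := hm ▸ min_le_left _ _
  have hm2 : m ≤ n₂ := hm ▸ min_le_right _ _
  rw [hm] at hVH1 ⊢
  rw [if_pos (show d % 2 + 2 ≤ m ∧ m ≤ 2 * ((n₁ + n₂ + n₃) / 2) + d % 2 ∧ 2 ∣ m - d % 2 from ⟨by omega, by omega, ⟨(m - d % 2) / 2, by omega⟩⟩),
    if_pos (show d % 2 + 2 ≤ n₂ ∧ n₂ ≤ 2 * ((n₁ + n₂ + n₃) / 2) + d % 2 ∧ 2 ∣ n₂ - d % 2 from ⟨by omega, by omega, ⟨(n₂ - d % 2) / 2, by omega⟩⟩),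
    if_pos (show d % 2 + 2 ≤ n₁ ∧ n₁ ≤ 2 * ((n₁ + n₂ + n₃) / 2) + d % 2 ∧ 2 ∣ n₁ - d % 2 from ⟨by omega, by omega, ⟨(n₁ - d % 2) / 2, by omega⟩⟩),
    if_pos (show d % 2 + 2 ≤ n₂ ∧ n₂ ≤ 2 * ((n₁ + n₂ + n₃) / 2) + d % 2 ∧ 2 ∣ n₂ - d % 2 from ⟨by omega, by omega, ⟨(n₂ - d % 2) / 2, by omega⟩⟩)]
  -- the three foot lines
  have hρ2 : 2 * ((n₂ - d % 2) / 2) + d % 2 = n₂ := by omega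
  have hρ1 : 2 * ((n₁ - d % 2) / 2) + d % 2 = n₁ := by omega
  rw [foot_line_total q ((![(ωA : ℚ) + ωm * ωC, 0, 0] : Fin 3 → ℚ) i) hd (show n₁ % 2 = d % 2 % 2 by omega) (by omega) hρ2 (by omega)
        (fun s => 2 * ((n₂ - d % 2) / 2) + s + d % 2 = n₁ ∧ 2 * ((n₂ - d % 2) / 2) + 2 + d % 2 ≤ min n₂ n₃) (fun s => n₁ ≠ n₂ + s) (κ₀ ((n₂ - d % 2) / 2))
        (fun s h => h.1) (fun s h => by omega) (fun s hs h2s => hκ0 _ s (by omega) hs h2s hρ2),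
      foot_line_total q ((![(0 : ℚ), (ωB : ℚ) + ωC, 0] : Fin 3 → ℚ) i) hd (show n₂ % 2 = d % 2 % 2 by omega) (by omega) hρ1 (by omega)
        (fun s => 2 * ((n₁ - d % 2) / 2) + s + d % 2 = n₂ ∧ 2 * ((n₁ - d % 2) / 2) + 2 + d % 2 ≤ min n₁ n₃) (fun s => n₂ ≠ n₁ + s) (κ₁ ((n₁ - d % 2) / 2))
        (fun s h => h.1) (fun s h => by omega) (fun s hs h2s => hκ1 _ s (by omega) hs h2s hρ1),
      foot_line_total q ((![(0 : ℚ), 0, (ωm : ℚ) * ωB + ωm * ωA] : Fin 3 → ℚ) i) hd (show n₃ % 2 = d % 2 % 2 by omega) (by omega) hρ2 (by omega)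
        (fun s => 2 * ((n₂ - d % 2) / 2) + s + d % 2 = n₃ ∧ 2 * ((n₂ - d % 2) / 2) + 2 + d % 2 ≤ m) (fun s => n₃ ≠ n₂ + s) (κ₂ ((n₂ - d % 2) / 2))
        (fun s h => h.1) (fun s h => by omega) (fun s hs h2s => hκ2 _ s (by omega) hs h2s hρ2)]
  -- exponents: `q^{n − ℓ₀} = q^{n − ℓ₀ − 1} · q`
  rw [show (q : ℚ) ^ (n₂ - d % 2) = (q : ℚ) ^ (n₂ - d % 2 - 1) * q by rw [← pow_succ]; congr 1; omega,
    show (q : ℚ) ^ (n₁ - d % 2) = (q : ℚ) ^ (n₁ - d % 2 - 1) * q by rw [← pow_succ]; congr 1; omega]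
  -- the hanging value
  rw [hVH1 _ (by omega) (by omega)]
  simp only [restTarget]
  rcases hiso with ⟨h12, h13⟩ | ⟨h13, h12⟩ | ⟨h23, h21⟩
  · subst h12
    have F1 : ¬ (n₁ + 2 * d ≤ n₁) := by omega
    have F2 : ¬ (n₁ + 2 = n₁ + 2 * d) := by omega
    have F3 : ¬ (n₁ + 2 * d ≤ n₁ + 2) := by omega
    fin_cases i <;>
      simp only [Fin.zero_eta, Fin.isValue, Fin.mk_one, Fin.reduceFinMk, Matrix.cons_val_zero, Matrix.cons_val_one, Matrix.cons_val_two,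
        Matrix.head_cons, Matrix.tail_cons, zero_div, zero_mul, neg_zero, ite_self, add_zero, true_and, and_false, ↓reduceIte, F1, F2, F3] <;>
      split_ifs <;> first | ring1 | (exfalso; omega)
  · subst h13
    have F1 : ¬ (n₂ + 2 * d ≤ n₁) := by omega
    have F2 : ¬ (n₁ + 2 = n₂ + 2 * d) := by omega
    have F3 : ¬ (n₁ + 2 * d ≤ n₁) := by omega
    have F4 : ¬ (n₁ + 2 = n₁ + 2 * d) := by omega
    have F5 : ¬ (n₂ + 2 * d ≤ n₁ + 2) := by omega
    have F6 : ¬ (n₁ + 2 * d ≤ n₁ + 2) := by omega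
    fin_cases i <;>
      simp only [Fin.zero_eta, Fin.isValue, Fin.mk_one, Fin.reduceFinMk, Matrix.cons_val_zero, Matrix.cons_val_one, Matrix.cons_val_two,
        Matrix.head_cons, Matrix.tail_cons, zero_div, zero_mul, neg_zero, ite_self, add_zero, true_and, and_false, ↓reduceIte, F1, F2, F3, F4, F5, F6] <;>
      split_ifs <;> first | ring1 | (exfalso; omega)
  · subst h23
    have F1 : ¬ (n₁ + 2 * d ≤ n₂) := by omega
    have F2 : ¬ (n₂ + 2 * d ≤ n₂) := by omega
    have F3 : ¬ (n₂ + 2 = n₁ + 2 * d) := by omega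
    have F4 : ¬ (n₁ + 2 * d ≤ n₂ + 2) := by omega
    fin_cases i <;>
      simp only [Fin.zero_eta, Fin.isValue, Fin.mk_one, Fin.reduceFinMk, Matrix.cons_val_zero, Matrix.cons_val_one, Matrix.cons_val_two,
        Matrix.head_cons, Matrix.tail_cons, zero_div, zero_mul, neg_zero, ite_self, add_zero, true_and, and_false, ↓reduceIte, F1, F2, F3, F4] <;>
      split_ifs <;> first | ring1 | (exfalso; omega)

/-! ## ED. 2 (append-only) — the ONE-TOKEN ADAPTER for the κ letters (chair LEDGER #15) -/

/-- **ONE-TOKEN ⟹ SYMMETRIC κ LETTER.**  A κ-class head landed with ONE token `t∕2` (e.g. `ωm·ωB∕2` on tower 3, ★ deep relations pending) equals `harith_of_values`'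
symmetric letter `τ∕4` POINTWISE as soon as `2t = τ` holds whenever the foot line is live (`c + 2d ≤ nX` — exactly where the ★ `…TowerSignRelationsDeep` relations
`ωB = ωA` ∕ `ωC = ωB` ∕ `ωC = ωm·ωA` are available): off that range both brackets vanish (`s ≥ 2` — the κ rows are stated for even `s ≥ 1` — and `2ρ + ℓ₀ = c`). [cite: Kottwitz1986BaseChangeUnits, §1 pp. 240–241] -/
theorem kappa_letter_of_oneToken (q : ℕ) {d l c nX ρ s : ℕ} (t τ : ℚ) (hρ : 2 * ρ + l = c) (hs : 2 ≤ s)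
    (hrel : c + 2 * d ≤ nX → 2 * t = τ) :
    t / 2 * (q : ℚ) ^ (2 * ρ - 1 + s / 2) *
        ((if 2 * d + l + 2 * ρ + s ≤ nX then (q : ℚ) - 1 else 0) - (if nX + 2 = 2 * d + l + 2 * ρ + s then 1 else 0)) =
      τ / 4 * (q : ℚ) ^ (2 * ρ - 1 + s / 2) *
        ((if 2 * d + l + 2 * ρ + s ≤ nX then (q : ℚ) - 1 else 0) - (if nX + 2 = 2 * d + l + 2 * ρ + s then 1 else 0)) := by
  by_cases h : c + 2 * d ≤ nX
  · rw [← hrel h]; ring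
  · rw [if_neg (show ¬ 2 * d + l + 2 * ρ + s ≤ nX by omega), if_neg (show ¬ nX + 2 = 2 * d + l + 2 * ρ + s by omega)]; ring

end Summit.HodgeConjecture.HodgeConjecture.Cruxes.H413.F0P3cDyRamOddLabelledRestArith
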